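import Mathlib
import Literature.Probability.RandomPlanarGeometry.PlanarDomainsTopology
import Literature.Probability.RandomPlanarGeometry.CaratheodoryExtension
import Literature.Topology.PlaneTopology.JordanCurveProofs

/-!
# A Jordan domain near a flat boundary point is a half-disc
# (helper for `DensityIntegration`, item stmt-CriticalPhenomena-14890, route CardyBoundaryCoulombGas)

`BoundaryDefectGaussianR` is stated for marked domains whose boundary is *flat* near each mark:
every frontier point within `r` of the mark has the same imaginary part (or the same real part).
To put the inverse uniformiser in standard position (`…DensityIntegrationFlatBoundary.lean`) and
to read the lattice boundary row, one needs the local picture this hypothesis encodes: for some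
`r' > 0` the frontier meets `B(z₀, r')` exactly in the diameter `{im = im z₀}`, and the domain
meets `B(z₀, r')` exactly in ONE of the two open half-discs. The proof uses the boundary loop
(continuous, injective on short intervals: the diameter near `z₀` is covered by the curve, by the
intermediate value theorem) and the Jordan curve theorem of the tree in the form
`JordanDomain.frontier_subset_closure_exterior` (the outside also accumulates at `z₀`).
-/

noncomputable section

open Set Metric Filter Topology

namespace Summit.CriticalPhenomena.CardyFormulaZ2.Theorems

open Literature.Probability.RandomPlanarGeometry

/-- **The boundary curve covers the diameter near a flat point.** If every frontier point within
`r` of `z₀ ∈ ∂D` has imaginary part `im z₀`, then for some `ρ > 0` every point `z` with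
`im z = im z₀` and `|re z − re z₀| < ρ` is a frontier point. [folklore] -/
theorem JordanDomain.diameter_subset_frontier_of_flat (D : JordanDomain) {z₀ : ℂ}
    (hz₀ : z₀ ∈ frontier D.carrier) {r : ℝ} (hr : 0 < r)
    (hflat : ∀ z ∈ frontier D.carrier, dist z z₀ < r → z.im = z₀.im) :
    ∃ ρ > 0, ∀ z : ℂ, z.im = z₀.im → |z.re - z₀.re| < ρ → z ∈ frontier D.carrier := by
  -- parametrise `z₀ = γ t₀`
  have hz₀' : z₀ ∈ range D.boundary := D.range_boundary ▸ hz₀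
  obtain ⟨t₀, ht₀⟩ := hz₀'
  set γ := D.boundary with hγ
  -- a short parameter interval mapped into `B(z₀, r)`
  obtain ⟨δ, hδ, hδr⟩ := Metric.continuous_iff.1 D.continuous_boundary t₀ r hr
  set η := min (δ / 2) (1 / 4) with hη
  have hη0 : 0 < η := by positivity
  have hηδ : η < δ := by
    have : η ≤ δ / 2 := min_le_left _ _
    linarith
  have hη1 : |(t₀ - η) - (t₀ + η)| < 1 := by
    rw [show (t₀ - η) - (t₀ + η) = -(2 * η) by ring, abs_neg, abs_of_pos (by positivity)]
    have : η ≤ 1 / 4 := min_le_right _ _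
    linarith
  have hI_ball : ∀ t ∈ Icc (t₀ - η) (t₀ + η), dist (γ t) z₀ < r := by
    intro t ht
    rw [← ht₀]
    exact hδr t (by rw [Real.dist_eq]; exact abs_lt.2 ⟨by linarith [ht.1], by linarith [ht.2]⟩)
  have hI_im : ∀ t ∈ Icc (t₀ - η) (t₀ + η), (γ t).im = z₀.im := fun t ht ↦
    hflat _ (D.boundary_mem_frontier t) (hI_ball t ht)
  -- `re ∘ γ` is continuous and injective on the interval, hence strictly monotone or antitone
  have hinjγ : InjOn γ (Icc (t₀ - η) (t₀ + η)) := by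
    have := D.injOn_boundary_uIcc hη1
    rwa [uIcc_of_le (by linarith)] at this
  set f : ℝ → ℝ := fun t ↦ (γ t).re with hf
  have hfc : ContinuousOn f (Icc (t₀ - η) (t₀ + η)) :=
    (Complex.continuous_re.comp D.continuous_boundary).continuousOn
  have hfi : InjOn f (Icc (t₀ - η) (t₀ + η)) := by
    intro s hs t ht hst
    exact hinjγ hs ht (Complex.ext hst (by rw [hI_im s hs, hI_im t ht]))
  have ht₀I : t₀ ∈ Icc (t₀ - η) (t₀ + η) := ⟨by linarith, by linarith⟩
  have hlI : t₀ - η ∈ Icc (t₀ - η) (t₀ + η) := left_mem_Icc.2 (by linarith)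
  have hrI : t₀ + η ∈ Icc (t₀ - η) (t₀ + η) := right_mem_Icc.2 (by linarith)
  have hf0 : f t₀ = z₀.re := by simp [hf, ht₀]
  have hne1 : f (t₀ - η) ≠ z₀.re := fun h ↦ by
    have := hfi hlI ht₀I (h.trans hf0.symm); linarith
  have hne2 : f (t₀ + η) ≠ z₀.re := fun h ↦ by
    have := hfi hrI ht₀I (h.trans hf0.symm); linarith
  set ρ := min |f (t₀ - η) - z₀.re| |f (t₀ + η) - z₀.re| with hρ
  have hρ0 : 0 < ρ := lt_min (abs_pos.2 (sub_ne_zero.2 hne1)) (abs_pos.2 (sub_ne_zero.2 hne2))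
  refine ⟨ρ, hρ0, fun z hzim hzre ↦ ?_⟩
  -- the value `re z` is taken by `f` on the interval (IVT), at a parameter `t`; then `z = γ t`
  have hρ1 : ρ ≤ |f (t₀ - η) - z₀.re| := min_le_left _ _
  have hρ2 : ρ ≤ |f (t₀ + η) - z₀.re| := min_le_right _ _
  have hmono := hfc.strictMonoOn_of_injOn_Icc' (by linarith : t₀ - η ≤ t₀ + η) hfi
  have hx1 : z.re ∈ uIcc (f (t₀ - η)) (f t₀) ∨ z.re ∈ uIcc (f t₀) (f (t₀ + η)) := by
    have hzlt := abs_lt.1 hzre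
    rw [hf0]
    rcases hmono with hm | hm
    · have h1 : f (t₀ - η) < z₀.re := by rw [← hf0]; exact hm hlI ht₀I (by linarith)
      have h2 : z₀.re < f (t₀ + η) := by rw [← hf0]; exact hm ht₀I hrI (by linarith)
      rw [abs_of_neg (sub_neg.2 h1)] at hρ1
      rw [abs_of_pos (sub_pos.2 h2)] at hρ2
      rcases le_or_gt z.re z₀.re with h | h
      · left; rw [uIcc_of_le h1.le]; exact ⟨by linarith, h⟩
      · right; rw [uIcc_of_le h2.le]; exact ⟨h.le, by linarith⟩
    · have h1 : z₀.re < f (t₀ - η) := by rw [← hf0]; exact hm hlI ht₀I (by linarith)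
      have h2 : f (t₀ + η) < z₀.re := by rw [← hf0]; exact hm ht₀I hrI (by linarith)
      rw [abs_of_pos (sub_pos.2 h1)] at hρ1
      rw [abs_of_neg (sub_neg.2 h2)] at hρ2
      rcases le_or_gt z.re z₀.re with h | h
      · right; rw [uIcc_of_ge h2.le]; exact ⟨by linarith, h⟩
      · left; rw [uIcc_of_ge h1.le]; exact ⟨h.le, by linarith⟩
  have hximg : ∃ t ∈ Icc (t₀ - η) (t₀ + η), f t = z.re := by
    rcases hx1 with h | h
    · have hsub : uIcc (t₀ - η) t₀ ⊆ Icc (t₀ - η) (t₀ + η) := by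
        rw [uIcc_of_le (by linarith)]; exact Icc_subset_Icc le_rfl (by linarith)
      obtain ⟨t, ht, hft⟩ := intermediate_value_uIcc (hfc.mono hsub) h
      exact ⟨t, hsub ht, hft⟩
    · have hsub : uIcc t₀ (t₀ + η) ⊆ Icc (t₀ - η) (t₀ + η) := by
        rw [uIcc_of_le (by linarith)]; exact Icc_subset_Icc (by linarith) le_rfl
      obtain ⟨t, ht, hft⟩ := intermediate_value_uIcc (hfc.mono hsub) h
      exact ⟨t, hsub ht, hft⟩
  obtain ⟨t, ht, hft⟩ := hximg
  have hzγ : z = γ t := Complex.ext (by simpa [hf] using hft.symm) (by rw [hzim, hI_im t ht])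
  rw [hzγ]
  exact D.boundary_mem_frontier t

/-- **A Jordan domain near a flat boundary point is a half-disc.** If every frontier point
within `r` of `z₀ ∈ ∂D` has imaginary part `im z₀`, then for some `r' > 0` the frontier meets
`B(z₀, r')` exactly in the diameter `{im = im z₀}` and `D` meets `B(z₀, r')` exactly in the upper
or exactly in the lower open half-disc (Jordan curve theorem: the exterior also accumulates at
`z₀`, `JordanDomain.frontier_subset_closure_exterior`). The vertical case (`re` in place of `im`)
is the same statement for the rotated domain. [folklore] -/
theorem JordanDomain.flat_halfDisc (D : JordanDomain) {z₀ : ℂ} (hz₀ : z₀ ∈ frontier D.carrier)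
    {r : ℝ} (hr : 0 < r) (hflat : ∀ z ∈ frontier D.carrier, dist z z₀ < r → z.im = z₀.im) :
    ∃ r' > 0, frontier D.carrier ∩ ball z₀ r' = {z ∈ ball z₀ r' | z.im = z₀.im} ∧
      (D.carrier ∩ ball z₀ r' = {z ∈ ball z₀ r' | z₀.im < z.im} ∨
        D.carrier ∩ ball z₀ r' = {z ∈ ball z₀ r' | z.im < z₀.im}) := by
  obtain ⟨ρ, hρ, hdiam⟩ := JordanDomain.diameter_subset_frontier_of_flat D hz₀ hr hflat
  set r' := min r ρ with hr'
  have hr'0 : 0 < r' := lt_min hr hρ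
  -- points of the ball: on the diameter iff on the frontier
  have hball_r : ∀ z ∈ ball z₀ r', dist z z₀ < r := fun z hz ↦
    (mem_ball.1 hz).trans_le (min_le_left _ _)
  have hdiam' : ∀ z ∈ ball z₀ r', z.im = z₀.im → z ∈ frontier D.carrier := by
    intro z hzb hzim
    refine hdiam z hzim ?_
    have h1 : |(z - z₀).re| ≤ ‖z - z₀‖ := Complex.abs_re_le_norm _
    rw [Complex.sub_re] at h1
    have h2 : ‖z - z₀‖ < r' := by rwa [← dist_eq_norm, ← mem_ball]
    exact h1.trans_lt (h2.trans_le (min_le_right _ _))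
  have hfront : frontier D.carrier ∩ ball z₀ r' = {z ∈ ball z₀ r' | z.im = z₀.im} := by
    ext z
    constructor
    · rintro ⟨hz, hzb⟩
      exact ⟨hzb, hflat z hz (hball_r z hzb)⟩
    · rintro ⟨hzb, hzim⟩
      exact ⟨hdiam' z hzb hzim, hzb⟩
  have hnotD : ∀ z ∈ frontier D.carrier, z ∉ D.carrier := fun z hz hzD ↦ by
    have := hz.2
    rw [D.isOpen.interior_eq] at this
    exact this hzD
  -- the exterior and the dichotomy for preconnected sets avoiding the frontier
  set ext : Set ℂ := (closure D.carrier)ᶜ with hext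
  have hext_open : IsOpen ext := isClosed_closure.isOpen_compl
  have hdisj : Disjoint D.carrier ext :=
    Set.disjoint_left.2 fun z hz hz' ↦ hz' (subset_closure hz)
  have key : ∀ H : Set ℂ, H ⊆ ball z₀ r' → (∀ z ∈ H, z.im ≠ z₀.im) → IsPreconnected H →
      H ⊆ D.carrier ∨ H ⊆ ext := by
    intro H hHb hHim hHc
    refine hHc.subset_or_subset D.isOpen hext_open hdisj fun z hz ↦ ?_
    by_contra hcon
    simp only [mem_union, not_or, hext, mem_compl_iff, not_not] at hcon
    have hzfr : z ∈ frontier D.carrier := ⟨hcon.2, by rw [D.isOpen.interior_eq]; exact hcon.1⟩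
    exact hHim z hz (hflat z hzfr (hball_r z (hHb hz)))
  set Hp : Set ℂ := {z ∈ ball z₀ r' | z₀.im < z.im} with hHp
  set Hm : Set ℂ := {z ∈ ball z₀ r' | z.im < z₀.im} with hHm
  have hp := key Hp (fun z hz ↦ hz.1) (fun z hz ↦ ne_of_gt hz.2)
    ((convex_ball z₀ r').inter (convex_halfSpace_im_gt z₀.im)).isPreconnected
  have hm := key Hm (fun z hz ↦ hz.1) (fun z hz ↦ ne_of_lt hz.2)
    ((convex_ball z₀ r').inter (convex_halfSpace_im_lt z₀.im)).isPreconnected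
  -- a point of `D` and a point of the exterior inside the ball, both off the diameter
  obtain ⟨y, hyD, hyb⟩ : ∃ y ∈ D.carrier, y ∈ ball z₀ r' := by
    obtain ⟨y, hy, hdy⟩ := Metric.mem_closure_iff.1 (frontier_subset_closure hz₀) r' hr'0
    exact ⟨y, hy, mem_ball_comm.1 (mem_ball.2 hdy)⟩
  obtain ⟨e, heE, heb⟩ : ∃ e ∈ ext, e ∈ ball z₀ r' := by
    have hzcl := JordanDomain.frontier_subset_closure_exterior D
      Literature.Topology.PlaneTopology.JordanCurveTheorem_holds hz₀
    obtain ⟨e, he, hde⟩ := Metric.mem_closure_iff.1 hzcl r' hr'0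
    exact ⟨e, he, mem_ball_comm.1 (mem_ball.2 hde)⟩
  have hy_im : y.im ≠ z₀.im := fun h ↦ hnotD y (hdiam' y hyb h) hyD
  have he_im : e.im ≠ z₀.im := fun h ↦ heE (frontier_subset_closure (hdiam' e heb h))
  have hDE : ∀ z, z ∈ D.carrier → z ∈ ext → False := fun z hzD hzE ↦
    Set.disjoint_left.1 hdisj hzD hzE
  refine ⟨r', hr'0, hfront, ?_⟩
  rcases lt_or_gt_of_ne hy_im with hy1 | hy1
  · -- `y` is in the lower half-disc: `Hm ⊆ D`, hence `Hp ⊆ ext`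
    have hHmD : Hm ⊆ D.carrier := by
      rcases hm with h | h
      · exact h
      · exact absurd (h ⟨hyb, hy1⟩) (fun hyE ↦ hDE y hyD hyE)
    have he1 : z₀.im < e.im := by
      rcases lt_or_gt_of_ne he_im with h | h
      · exact absurd (hHmD ⟨heb, h⟩) (fun heD ↦ hDE e heD heE)
      · exact h
    have hHpE : Hp ⊆ ext := by
      rcases hp with h | h
      · exact absurd (h ⟨heb, he1⟩) (fun heD ↦ hDE e heD heE)
      · exact h
    refine Or.inr (Set.ext fun z ↦ ⟨fun ⟨hzD, hzb⟩ ↦ ⟨hzb, ?_⟩, fun hz ↦ ⟨hHmD hz, hz.1⟩⟩)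
    rcases lt_trichotomy z.im z₀.im with h | h | h
    · exact h
    · exact absurd hzD (hnotD z (hdiam' z hzb h))
    · exact absurd (hHpE ⟨hzb, h⟩) (fun hzE ↦ hDE z hzD hzE)
  · -- `y` is in the upper half-disc: `Hp ⊆ D`, hence `Hm ⊆ ext`
    have hHpD : Hp ⊆ D.carrier := by
      rcases hp with h | h
      · exact h
      · exact absurd (h ⟨hyb, hy1⟩) (fun hyE ↦ hDE y hyD hyE)
    have he1 : e.im < z₀.im := by
      rcases lt_or_gt_of_ne he_im with h | h
      · exact h
      · exact absurd (hHpD ⟨heb, h⟩) (fun heD ↦ hDE e heD heE)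
    have hHmE : Hm ⊆ ext := by
      rcases hm with h | h
      · exact absurd (h ⟨heb, he1⟩) (fun heD ↦ hDE e heD heE)
      · exact h
    refine Or.inl (Set.ext fun z ↦ ⟨fun ⟨hzD, hzb⟩ ↦ ⟨hzb, ?_⟩, fun hz ↦ ⟨hHpD hz, hz.1⟩⟩)
    rcases lt_trichotomy z.im z₀.im with h | h | h
    · exact absurd (hHmE ⟨hzb, h⟩) (fun hzE ↦ hDE z hzD hzE)
    · exact absurd hzD (hnotD z (hdiam' z hzb h))
    · exact h

end Summit.CriticalPhenomena.CardyFormulaZ2.Theorems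

end
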